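import Mathlib
import HarnessLib
import Summits.QuantumAdvantage.Statement
import Literature.Computability.QuantumComplexity.SignedExactCubicSliceANF
import Literature.Computability.QuantumComplexity.CubicForrelation
import Literature.Computability.QuantumComplexity.Forrelation
import Literature.Computability.QuantumComplexity.SignedForrelationGadget
import Literature.Computability.QuantumComplexity.ForrelationSignTransport
import Literature.Computability.QuantumComplexity.ForrelationDirectSum
import Literature.Computability.QuantumComplexity.SimonFourier
import Literature.Computability.QuantumComplexity.IQPForrelation
import Literature.Computability.QuantumComplexity.MSubspaceSignReadoutRelaxedRuns
import Literature.Computability.Cryptography.ClassBQP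
import Literature.Computability.Complexity.Promise
import Literature.Computability.Complexity.PromiseZPPProofs
import Literature.Computability.Complexity.ConstantDepth
import Literature.Computability.Complexity.ACRealizeOver
import Literature.Computability.Complexity.CircuitLowerBounds
import Literature.Computability.Complexity.FPStringBricks
import Literature.Computability.Complexity.Classes
import Literature.Computability.MetaComplexity.SmolenskyModq
import Literature.Computability.MetaComplexity.RazborovSmolenskyApprox
import Literature.Computability.MetaComplexity.SmolenskyProperty
import Literature.Computability.Complexity.CircuitClassesProofs

/-!
# HintDialDuality — module 1/10 of the HintDial THEOREMS package (cell decomp-qadv, lens-3 generation 6)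

§1–§2: plumbing; exact pairs = bent functions with their duals (partner uniqueness, sign flip).

Provenance: split of the farm-checked single file `HintDialTheorems.lean` (HOME/decomp-qadv-lens-3/g6/tree/; rc 0 · no proof holes ·
axioms ⊆ {propext, Classical.choice, Quot.sound}); mathematical record: HOME/decomp-qadv-lens-3/g6/NODE-g6.md.  Modules in order:
HintDialDuality → HintDialLevels → HintDialAutomaton → HintDialLeakLaw → HintDialPlanting → HintDialClosure → HintDialTable → HintDialLowDegree → HintDialAnfLadder → HintDialCovariance (each imports its predecessor).  Namespace `Summit.QuantumAdvantage.QuantumAdvantage.Theorems.HintDial`.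
-/

set_option linter.dupNamespace false

noncomputable section

namespace Summit.QuantumAdvantage.QuantumAdvantage.Theorems.HintDial

open Finset
open Literature.Computability.Complexity
open Literature.Computability.QuantumComplexity
open Literature.Computability.MetaComplexity
open _root_.Computability (encodeNat)
/-! ## §1 Plumbing -/

/-! ## §2 Exact pairs = bent functions with their duals (the certificate behind the translation)

`Φ(f,g) = 2^{-3n/2} Σ_y (-1)^{g(y)} W_{(-1)^f}(y)` with `|W| ≤ 2^{n/2}·…`; `Φ = 1` forces `W_{(-1)^f}(y) = 2^{n/2}(-1)^{g(y)}`
for EVERY `y` (`DerivativeWalsh.two_pow_mul_W_eq`, the equality case of Cauchy–Schwarz, in the tree): `f` is bent and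
`g` is its dual [Rothaus 1976; Carlet 2020 §6.1].  Consequences used by the dial: the `+1`-partner of `F` is UNIQUE as a
function (`partner_unique`), flipping the constant of `G` flips the sign (`Literature.Computability.QuantumComplexity.DerivativeWalsh.forrelation_not_right`). -/

section Duality

open CubicForm (bit)
open DerivativeWalsh (W fsum)

variable {n : ℕ}

/-- HintDial helper `signOf_injective` (lens-3 g6 HintDial THEOREMS package; see the enclosing section docstring). -/
theorem signOf_injective : Function.Injective signOf := by
  intro a b h; cases a <;> cases b <;> first | rfl | (exfalso; norm_num [signOf] at h)

/-- `g` is THE DUAL of `f`: `W_{(-1)^f}(y) = 2^{n/2}·(-1)^{g(y)}` for every `y` (so `f` is bent). [cite: Carlet2020, Def. 6.1.2]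
When `f = g = q` this is definitionally `SgnForrMem.IsSelfDualBent q` (reviewer note p774682). -/
def IsDualOf (f g : (Fin n → Bool) → Bool) : Prop :=
  ∀ y, W (fun x => signOf (f x)) y = Real.sqrt (2 ^ n) * signOf (g y)

/-- ★ An exact `+1` pair is a bent function together with its dual. -/
theorem isDualOf_of_forrelation_eq_one {f g : (Fin n → Bool) → Bool} (h : forrelation f g = 1) : IsDualOf f g := by
  intro y
  have hsym : forrelation g f = 1 := by rw [Literature.Computability.QuantumComplexity.MMReadout.forrelation_symm', h]
  have hS : fsum (fun x => signOf (g x)) (fun y => signOf (f y)) ^ 2 = (8 : ℝ) ^ n :=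
    DerivativeWalsh.fsum_signOf_sq_of_forrelation_sq g f (by rw [hsym]; norm_num)
  have key := DerivativeWalsh.two_pow_mul_W_eq (fun x => signOf (g x)) (fun x => signOf (f x))
    (fun x => BuzetChailloux.signOf_sq (g x)) (fun x => BuzetChailloux.signOf_sq (f x)) hS y
  rw [DerivativeWalsh.fsum_signOf_eq, hsym, mul_one, DerivativeWalsh.sqrt_two_pow_three_mul, mul_assoc] at key
  exact mul_left_cancel₀ (by positivity) key

/-- Conversely, a bent function and its dual form an exact `+1` pair. -/
theorem forrelation_eq_one_of_isDualOf {f g : (Fin n → Bool) → Bool} (h : IsDualOf f g) : forrelation f g = 1 := by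
  rw [SgnForrMem.forrelation_eq_sum_W]
  have e : ∀ y : Fin n → Bool, signOf (g y) * W (fun x => signOf (f x)) y = Real.sqrt (2 ^ n) := fun y => by
    rw [h y]
    have := BuzetChailloux.signOf_sq (g y)
    rw [sq] at this
    calc signOf (g y) * (Real.sqrt (2 ^ n) * signOf (g y)) = Real.sqrt (2 ^ n) * (signOf (g y) * signOf (g y)) := by ring
      _ = _ := by rw [this, mul_one]
  simp_rw [e, sum_const, card_univ, Fintype.card_fun, Fintype.card_bool, Fintype.card_fin, nsmul_eq_mul]
  rw [DerivativeWalsh.sqrt_two_pow_three_mul]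
  have h2 : (0 : ℝ) < 2 ^ n := by positivity
  have hs : (0 : ℝ) < Real.sqrt (2 ^ n) := Real.sqrt_pos.2 h2
  push_cast
  field_simp

/-- ★ Uniqueness of the dual: two exact `+1` partners of the same `f` coincide AS FUNCTIONS. -/
theorem partner_unique {f g₀ g₁ : (Fin n → Bool) → Bool} (h₀ : forrelation f g₀ = 1) (h₁ : forrelation f g₁ = 1) :
    g₀ = g₁ := by
  funext y
  have e₀ := isDualOf_of_forrelation_eq_one h₀ y
  have e₁ := isDualOf_of_forrelation_eq_one h₁ y
  rw [e₀] at e₁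
  exact signOf_injective (mul_left_cancel₀ (by positivity) e₁)

/-! ### Table facts: bit semantics, flipping the constant, the value at `0` -/

/-- HintDial helper `bit_xor` (lens-3 g6 HintDial THEOREMS package; see the enclosing section docstring). -/
theorem bit_xor (a b : Bool) : bit (xor a b) = bit a + bit b := by cases a <;> cases b <;> decide
/-- HintDial helper `bit_and` (lens-3 g6 HintDial THEOREMS package; see the enclosing section docstring). -/
theorem bit_and (a b : Bool) : bit (a && b) = bit a * bit b := by cases a <;> cases b <;> decide
/-- HintDial helper `bit_not` (lens-3 g6 HintDial THEOREMS package; see the enclosing section docstring). -/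
theorem bit_not (a : Bool) : bit (!a) = bit a + 1 := by cases a <;> decide
/-- HintDial helper `bit_eq_ite` (lens-3 g6 HintDial THEOREMS package; see the enclosing section docstring). -/
theorem bit_eq_ite (b : Bool) : bit b = if b = true then 1 else 0 := by cases b <;> rfl
/-- HintDial helper `bit_false` (lens-3 g6 HintDial THEOREMS package; see the enclosing section docstring). -/
@[simp] theorem bit_false : bit false = 0 := rfl
/-- HintDial helper `bit_true` (lens-3 g6 HintDial THEOREMS package; see the enclosing section docstring). -/
@[simp] theorem bit_true : bit true = 1 := rfl
/-- HintDial helper `bit_mul_self` (lens-3 g6 HintDial THEOREMS package; see the enclosing section docstring). -/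
theorem bit_mul_self (a : Bool) : bit a * bit a = bit a := by cases a <;> decide
/-- HintDial helper `bit_injective` (lens-3 g6 HintDial THEOREMS package; see the enclosing section docstring). -/
theorem bit_injective : Function.Injective bit := by
  intro a b h; cases a <;> cases b <;> first | rfl | exact absurd h (by decide)
/-- HintDial helper `bit_decide_odd` (lens-3 g6 HintDial THEOREMS package; see the enclosing section docstring). -/
theorem bit_decide_odd (k : ℕ) : bit (decide (Odd k)) = (k : ZMod 2) := by
  by_cases h : Odd k
  · rw [decide_eq_true h, (ZMod.natCast_eq_one_iff_odd).2 h]; rfl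
  · rw [decide_eq_false h, (ZMod.natCast_eq_zero_iff_even).2 (Nat.not_odd_iff_even.1 h)]; rfl
/-- HintDial helper `bit_decide` (lens-3 g6 HintDial THEOREMS package; see the enclosing section docstring). -/
theorem bit_decide (p : Prop) [Decidable p] : bit (decide p) = if p then 1 else 0 := by
  by_cases h : p <;> simp [h, bit]

/-- The table semantics in `𝔽₂`: `F(x) = const + Σ_{i,j,l} cube i j l · xᵢ xⱼ x_l`. -/
theorem eval_bit (F : CubicForm n) (x : Fin n → Bool) :
    bit (F.eval x) = bit F.const + ∑ i, ∑ j, ∑ l, bit (F.cube i j l) * (bit (x i) * bit (x j) * bit (x l)) := by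
  rw [CubicForm.eval_def, polyPhase_apply]
  have e : bit (decide (MvPolynomial.eval (fun j => bit (x j)) F.toPoly = 1)) = MvPolynomial.eval (fun j => bit (x j)) F.toPoly := by
    generalize MvPolynomial.eval (fun j => bit (x j)) F.toPoly = v
    fin_cases v <;> decide
  rw [show (fun j => if x j then (1 : ZMod 2) else 0) = (fun j => bit (x j)) from rfl, e]
  simp only [CubicForm.toPoly, map_add, map_sum, map_mul, MvPolynomial.eval_C, MvPolynomial.eval_X]

/-- Flipping the constant bit of a table complements the presented function. -/
def flipConst (G : CubicForm n) : CubicForm n := ⟨!G.const, G.cube⟩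

/-- HintDial helper `eval_flipConst` (lens-3 g6 HintDial THEOREMS package; see the enclosing section docstring). -/
theorem eval_flipConst (G : CubicForm n) (y : Fin n → Bool) : (flipConst G).eval y = !(G.eval y) :=
  bit_injective (by rw [eval_bit, bit_not, eval_bit]; simp only [flipConst, bit_not]; ring)

/-- HintDial helper `flipConst_flipConst` (lens-3 g6 HintDial THEOREMS package; see the enclosing section docstring). -/
theorem flipConst_flipConst (G : CubicForm n) : flipConst (flipConst G) = G := by
  cases G; simp [flipConst]

/-- The presented function at `0` is the constant bit. -/
theorem eval_zero (G : CubicForm n) : G.eval (fun _ => false) = G.const :=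
  bit_injective (by rw [eval_bit]; simp [bit])

/-- HintDial helper `value_flipConst` (lens-3 g6 HintDial THEOREMS package; see the enclosing section docstring). -/
theorem value_flipConst (n : ℕ) (F G : CubicForm n) :
    (⟨n, F, flipConst G⟩ : CubicANFPair).value = - (⟨n, F, G⟩ : CubicANFPair).value := by
  show forrelation F.eval (flipConst G).eval = - forrelation F.eval G.eval
  rw [← Literature.Computability.QuantumComplexity.DerivativeWalsh.forrelation_not_right]
  congr 1; funext y; exact eval_flipConst G y

end Duality

end Summit.QuantumAdvantage.QuantumAdvantage.Theorems.HintDial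

end
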